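import Mathlib.GroupTheory.SpecificGroups.Dihedral
import Mathlib.Data.ZMod.Basic
import Literature.Combinatorics.Additive.TripleProductProperty
import HarnessLib

/-!
# ω-census family (b3): `ℤ₅ × D₁₀` realizes `⟨4,4,4⟩` and `⟨2,4,8⟩` — TPP volume `64 > 60 = 5 · β(D₁₀)` (kernel witnesses)

Cell `pub-omega` (HOME `run/shared/lean/pub/pub-omega/`, unit `pub-omega-eng2`, ENG2 gen 4), topic
`Summits/MatrixMultiplication/OmegaCensus`.  Framing (verbatim): lottery ticket; floor = certified bounds/negative ranges.
HONEST FRAMING: two explicit triple-product-property triples in ONE group of order `50`, checked by the kernel (`decide`);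
a structural datum for the census (row R196: the product heuristic `β(C_m × D_{2n}) = m · β(D_{2n})` FAILS for `ℤ₅ × D₁₀`,
since `β(D₁₀) = 12` (tree `dihedral10_realizes_223` and the dihedral law, `NR22`) while `ℤ₅ × D₁₀` carries TPP triples of
volume `64 > 5 · 12`).  NOT a hit and no progress on `ω`: `64 < Σ dᵢ³ = 90` for `ℤ₅ × D₁₀` (degrees `1^{10} 2^{10}`), so
Cohn–Umans' Theorem 1.8 yields nothing below `3` from these triples; the census also certified (SAT + DRAT ×2 seats, not in
this file) that NO triple of `ℤ₅ × D₁₀` has volume `65` or `66`, i.e. `β(ℤ₅ × D₁₀) = 64`.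

The group is written as `Multiplicative (ZMod 5) × DihedralGroup 5` (Mathlib: `r i * r j = r (i+j)`, `r i * sr j = sr (j-i)`,
`sr i * r j = sr (i+j)`, `sr i * sr j = r (j-i)`).  The witnesses were found by ENG2's SAT encoder `eng2.tppsat` + kissat
(kit j099837, 2026-08-20) on its own table of `(ℤ₅ × ℤ₅) ⋊ C₂` with involution `(x,y) ↦ (x,−y)` and transported by
`((x,y),0) ↦ (x, r y)`, `((x,y),1) ↦ (x, sr (−y))`; re-verified by three further programs (ENG2 hub script, referee, group seat)
before this kernel check.

References: Cohn–Umans 2003, Def. 2.1 (TPP) [CohnUmans2003]; Cohn–Kleinberg–Szegedy–Umans 2005, Def. 1.3 / Thm. 1.8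
[CohnKleinbergSzegedyUmans2005]; Hedtke–Murthy 2012 (TPP capacity `β`) [HedtkeMurthy2012].
-/

namespace Summit.MatrixMultiplication.OmegaCensus

open Literature.Combinatorics.Additive

/-- **`ℤ₅ × D₁₀` realizes `⟨4,4,4⟩`** (TPP volume `64`): `S = {(0,1), (3,r), (0,sr³), (3,sr²)}`, `T = {(0,1), (2,r), (3,r⁴), (4,r²)}`,
`U = {(0,1), (1,r²), (0,sr⁴), (1,sr²)}` (first coordinate written additively in `ℤ₅`). Kernel `decide`. -/
theorem c5_dihedral10_realizes_4_4_4 :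
    TripleProductProperty
      ({(Multiplicative.ofAdd (0 : ZMod 5), DihedralGroup.r (0 : ZMod 5)), (Multiplicative.ofAdd 3, DihedralGroup.r 1),
        (Multiplicative.ofAdd 0, DihedralGroup.sr 3), (Multiplicative.ofAdd 3, DihedralGroup.sr 2)} :
        Finset (Multiplicative (ZMod 5) × DihedralGroup 5))
      ({(Multiplicative.ofAdd (0 : ZMod 5), DihedralGroup.r (0 : ZMod 5)), (Multiplicative.ofAdd 2, DihedralGroup.r 1),
        (Multiplicative.ofAdd 3, DihedralGroup.r 4), (Multiplicative.ofAdd 4, DihedralGroup.r 2)} :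
        Finset (Multiplicative (ZMod 5) × DihedralGroup 5))
      ({(Multiplicative.ofAdd (0 : ZMod 5), DihedralGroup.r (0 : ZMod 5)), (Multiplicative.ofAdd 1, DihedralGroup.r 2),
        (Multiplicative.ofAdd 0, DihedralGroup.sr 4), (Multiplicative.ofAdd 1, DihedralGroup.sr 2)} :
        Finset (Multiplicative (ZMod 5) × DihedralGroup 5)) := by
  unfold TripleProductProperty; decide +kernel

/-- The three sets of `c5_dihedral10_realizes_4_4_4` have `4` elements each (so the volume is `4·4·4 = 64`). -/
theorem c5_dihedral10_witness_4_4_4_cards :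
    ({(Multiplicative.ofAdd (0 : ZMod 5), DihedralGroup.r (0 : ZMod 5)), (Multiplicative.ofAdd 3, DihedralGroup.r 1),
        (Multiplicative.ofAdd 0, DihedralGroup.sr 3), (Multiplicative.ofAdd 3, DihedralGroup.sr 2)} :
        Finset (Multiplicative (ZMod 5) × DihedralGroup 5)).card = 4 ∧
    ({(Multiplicative.ofAdd (0 : ZMod 5), DihedralGroup.r (0 : ZMod 5)), (Multiplicative.ofAdd 2, DihedralGroup.r 1),
        (Multiplicative.ofAdd 3, DihedralGroup.r 4), (Multiplicative.ofAdd 4, DihedralGroup.r 2)} :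
        Finset (Multiplicative (ZMod 5) × DihedralGroup 5)).card = 4 ∧
    ({(Multiplicative.ofAdd (0 : ZMod 5), DihedralGroup.r (0 : ZMod 5)), (Multiplicative.ofAdd 1, DihedralGroup.r 2),
        (Multiplicative.ofAdd 0, DihedralGroup.sr 4), (Multiplicative.ofAdd 1, DihedralGroup.sr 2)} :
        Finset (Multiplicative (ZMod 5) × DihedralGroup 5)).card = 4 := by
  refine ⟨?_, ?_, ?_⟩ <;> decide

/-- **`ℤ₅ × D₁₀` realizes `⟨2,4,8⟩`** (TPP volume `64`): `S = {(0,1), (0,s)}`, `T = {(0,1), (2,r²), (3,r³), (4,r⁴)}`,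
`U = {(0,1), (2,r³), (3,r²), (4,r), (0,sr³), (2,s), (3,sr), (4,sr²)}`. Kernel `decide`. -/
theorem c5_dihedral10_realizes_2_4_8 :
    TripleProductProperty
      ({(Multiplicative.ofAdd (0 : ZMod 5), DihedralGroup.r (0 : ZMod 5)), (Multiplicative.ofAdd 0, DihedralGroup.sr 0)} :
        Finset (Multiplicative (ZMod 5) × DihedralGroup 5))
      ({(Multiplicative.ofAdd (0 : ZMod 5), DihedralGroup.r (0 : ZMod 5)), (Multiplicative.ofAdd 2, DihedralGroup.r 2),
        (Multiplicative.ofAdd 3, DihedralGroup.r 3), (Multiplicative.ofAdd 4, DihedralGroup.r 4)} :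
        Finset (Multiplicative (ZMod 5) × DihedralGroup 5))
      ({(Multiplicative.ofAdd (0 : ZMod 5), DihedralGroup.r (0 : ZMod 5)), (Multiplicative.ofAdd 2, DihedralGroup.r 3),
        (Multiplicative.ofAdd 3, DihedralGroup.r 2), (Multiplicative.ofAdd 4, DihedralGroup.r 1), (Multiplicative.ofAdd 0, DihedralGroup.sr 3),
        (Multiplicative.ofAdd 2, DihedralGroup.sr 0), (Multiplicative.ofAdd 3, DihedralGroup.sr 1), (Multiplicative.ofAdd 4, DihedralGroup.sr 2)} :
        Finset (Multiplicative (ZMod 5) × DihedralGroup 5)) := by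
  unfold TripleProductProperty; decide +kernel

/-- **`ℤ₅ × D₁₀` realizes `⟨4,4,4⟩`** in the census's existential form: there are `S, T, U ⊆ ℤ₅ × D₁₀` with the triple product property
and `|S| = |T| = |U| = 4` (volume `64`). [cite: HedtkeMurthy2012, Def. 1.2] -/
theorem c5_dihedral10_exists_tpp_4_4_4 : ∃ S T U : Finset (Multiplicative (ZMod 5) × DihedralGroup 5),
    TripleProductProperty S T U ∧ S.card = 4 ∧ T.card = 4 ∧ U.card = 4 :=
  ⟨_, _, _, c5_dihedral10_realizes_4_4_4, c5_dihedral10_witness_4_4_4_cards⟩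

end Summit.MatrixMultiplication.OmegaCensus
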